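import Summits.QuantumAdvantage.QuantumAdvantage.Theses.WhiteBoxWalk
import Literature.Computability.Cryptography.IndistinguishabilityObfuscatorSubexp
import Literature.Computability.Cryptography.PuncturablePRF
import Literature.Computability.QuantumComplexity.GluedTrees

/-!
# Sketch for crux idea `knowledge-of-walk-split` (crux `WbwObfuscatedGluedTrees`, item stmt-QuantumAdvantage-2340)

Ideator 2 (gen 2), round 1.  The idea: the classical/quantum separator for the obfuscated glued
trees is EXTRACTABILITY ("rootedness"), not indistinguishability.  Typed objects:

* `ClauseC gen ans` — clause (C) of `WbwThesis` (verbatim conjunct) with `wbwThesis_iff`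
  (`Iff.rfl`); same abstraction as `Disproof.lean` §0 and the other ideators' sketches.
* `WalkModel` — the walk semantics of instance strings (entrance name, name length, neighbour
  listing); `WalkModel.endpoint x w` executes a walk-word `w : List ℕ` (sorted-position choices)
  from the ENTRANCE of instance `x`.
* `KnowledgeOfWalk M gen` (KWA) — the white-box knowledge-of-walk axiom for CLASSICAL PPT:
  every PPT `A` has a PPT extractor `E` (reading `A`'s input AND coins) such that
  "A outputs a valid non-entrance name y but E's word does not end at y" is negligible.
* `WordHard M gen ans` — no PPT outputs a walk-word from the ENTRANCE to the answer (white-box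
  path-finding hardness; advantage-neutral: conjecturally true against quantum machines too).
* FIRST LEMMA `ClauseCOfKnowledge` : Coherent → KWA → WordHard → ClauseC (provable now, modulo
  PPT-closure plumbing: the stand-alone word finder samples `A`'s coins and runs `E`).
* `CruxPlus obfGen M` = the transferred crux C⁺ (KWA ∧ WordHard for the crux's generator under
  the crux's hypotheses) and the CHECKED glue `cruxShape_of_cruxPlus : ClauseCOfKnowledge →
  coherence → CruxPlus obfGen M → CruxShape obfGen` (`CruxShape` verbatim from Disproof.lean §0).
* `QuantumWordHard` — the standing bet (quantum path finding hard; consistency condition, not a proof step).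
* `BlackBox.ClassicalRootedness` — the black-box fact behind KWA's classical plausibility
  (CCDFGS 2003 Game 1 → Game 2: a transcript algorithm never names an unrevealed vertex except
  with probability ≤ t·2^{n+2}/(2^{2n} − 4t − 1)), typed over the tree's `GluedTrees.Outcome`,
  `strOracle`, `OracleAlg.queries`.

Nothing here is proved except `wbwThesis_iff` and `cruxShape_of_cruxPlus`.
-/

set_option linter.dupNamespace false

namespace Summit.QuantumAdvantage.QuantumAdvantage.Theses.WhiteBoxWalk.CruxIdeas.KnowledgeOfWalk

open Literature.Computability.Cryptography Literature.Computability.Complexity Filter Asymptotics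
open Literature.Computability.QuantumComplexity

/-! ## §0 Clause (C), abstracted (verbatim conjunct of the route decl) -/

/-- Clause (C) of `WbwThesis` for a fixed generator/answer pair `(gen, ans)`. -/
def ClauseC (gen ans : List Bool → List Bool) : Prop :=
  ∀ A : RandAlg (List Bool) (List Bool), IsPPT A id →
    SuperpolynomialDecay atTop (fun n : ℕ => (n : ℝ)) (fun n : ℕ =>
      uniformAvg n fun s => A.pr id (boolPair (Computability.unaryEncodeNat n) (gen s)) {y | ans s <+: y})

/-- The abstraction is faithful. -/
theorem wbwThesis_iff :
    WbwThesis ↔ ∃ (gen ans : List Bool → List Bool), PolyTimeComputable id id gen ∧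
      (∃ p : Polynomial ℕ, ∀ s, (ans s).length = p.eval (gen s).length) ∧
      (∃ F : QCircuitFamily cliffordT, F.IsOracleFree ∧ F.IsUniform ∧
        ∀ s, 2 / 3 ≤ F.kernelProb 0 (gen s) {y | ans s <+: y}) ∧ ClauseC gen ans :=
  Iff.rfl

/-! ## §1 Walk semantics of an instance string -/

/-- The walk semantics of instance strings `x = ⟨code of iO(N_k), name of ENTRANCE⟩`: the
entrance name, the common length of vertex names, and the neighbour LISTING computed by the
(obfuscated) neighbour circuit (`none` = the invalid answer `⊥`; the list is in the canonical
sorted order of `gluedTreesOracle`).  Only the SHAPE is fixed here; the concrete model is read off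
`obfuscatedGluedTreesGen` once that definition lands (evaluate the encoded circuit list). -/
structure WalkModel where
  /-- name of the ENTRANCE carried by the instance -/
  entrance : List Bool → List Bool
  /-- the common length of vertex names of the instance -/
  nameLen : List Bool → ℕ
  /-- neighbour listing of the instance on a name (`none` on invalid names) -/
  nbrs : List Bool → List Bool → Option (List (List Bool))

namespace WalkModel

/-- Execute the walk-word `w` (read right to left; each letter = a position in the sorted
neighbour list) from the ENTRANCE of instance `x`; `none` if the walk leaves the valid names. -/
def endpoint (M : WalkModel) (x : List Bool) : List ℕ → Option (List Bool)
  | [] => some (M.entrance x)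
  | i :: w => (endpoint M x w).bind fun cur => (M.nbrs x cur).bind fun l => l[i]?

/-- `y` is a valid vertex name of instance `x`. -/
def IsValid (M : WalkModel) (x y : List Bool) : Prop := (M.nbrs x y).isSome = true

end WalkModel

/-- The adversary's input at level `n` and seed `s`: `⟨1ⁿ, gen s⟩`. -/
def inst (gen : List Bool → List Bool) (n : ℕ) (s : List Bool) : List Bool :=
  boolPair (Computability.unaryEncodeNat n) (gen s)

/-! ## §2 The knowledge-of-walk axiom (classical, white-box) and word hardness -/

/-- Joint law of (`A`'s output, `E`'s output) on input `z`, where the extractor `E` reads `A`'s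
input AND `A`'s coin string (the non-black-box access a knowledge assumption posits;
Arabadjieva–Gheorghiu–Gitton–Metger arXiv:2405.15736 §1: "an efficient extractor that receives
as input A's random coins"). -/
noncomputable def jointPMF (A : RandAlg (List Bool) (List Bool)) (E : RandAlg (List Bool) (List ℕ))
    (z : List Bool) : PMF (List Bool × List ℕ) :=
  (PMF.uniformOfFintype (List.Vector Bool (A.coinLen z.length))).bind fun r =>
    (E.outputPMF id (boolPair z r.toList)).map fun w => (A.run z r.toList, w)

/-- Probability of an event of the joint experiment. -/
noncomputable def jointPr (A : RandAlg (List Bool) (List Bool)) (E : RandAlg (List Bool) (List ℕ))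
    (z : List Bool) (Ev : Set (List Bool × List ℕ)) : ℝ :=
  ((jointPMF A E z).toOuterMeasure Ev).toReal

/-- **KWA — knowledge of walk (classical PPT, white-box).**  For every PPT `A` there is a PPT
extractor `E` (input: `A`'s input and coins; output: a walk-word) such that the event
"the name part of `A`'s output is a valid vertex name other than the ENTRANCE, yet `E`'s word does
not end there" has probability decaying superpolynomially, on average over the seed.
The white-box analogue of ROOTEDNESS (Childs–Coudron–Gilani arXiv:2211.12447: an algorithm is
rooted if it maintains an ENTRANCE-path to every vertex label in its state).  Classically it is the
ideal-model truth (`BlackBox.ClassicalRootedness`); its QUANTUM analogue is false iff glued-trees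
path finding is quantumly hard (open; proved for genuine rooted algorithms, ibid. §4). -/
def KnowledgeOfWalk (M : WalkModel) (gen : List Bool → List Bool) : Prop :=
  ∀ A : RandAlg (List Bool) (List Bool), IsPPT A id →
    ∃ E : RandAlg (List Bool) (List ℕ), IsPPT E encodingListNatBool.encode ∧
      SuperpolynomialDecay atTop (fun n : ℕ => (n : ℝ)) (fun n : ℕ =>
        uniformAvg n fun s => jointPr A E (inst gen n s)
          {p | M.IsValid (gen s) (p.1.take (M.nameLen (gen s))) ∧
               p.1.take (M.nameLen (gen s)) ≠ M.entrance (gen s) ∧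
               M.endpoint (gen s) p.2 ≠ some (p.1.take (M.nameLen (gen s)))})

/-- **WordHard — white-box path-finding hardness (advantage-neutral).**  No PPT, given
`⟨1ⁿ, gen s⟩`, outputs a walk-word from the ENTRANCE whose endpoint is the answer `ans s`
(= the name of the EXIT for the crux's generator). -/
def WordHard (M : WalkModel) (gen ans : List Bool → List Bool) : Prop :=
  ∀ E : RandAlg (List Bool) (List ℕ), IsPPT E encodingListNatBool.encode →
    SuperpolynomialDecay atTop (fun n : ℕ => (n : ℝ)) (fun n : ℕ =>
      uniformAvg n fun s => E.pr id (inst gen n s) {w | M.endpoint (gen s) w = some (ans s)})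

/-- The walk model is coherent with `(gen, ans)`: the answer is a valid vertex name of the right
length and is not the ENTRANCE (for the crux's generator: `ans s = name_k(EXIT)`). -/
def Coherent (M : WalkModel) (gen ans : List Bool → List Bool) : Prop :=
  ∀ s, (ans s).length = M.nameLen (gen s) ∧ M.IsValid (gen s) (ans s) ∧ ans s ≠ M.entrance (gen s)

/-- **First lemma (the split).**  Under coherence, KWA and WordHard give clause (C):
`Pr[ans s <+: A] ≤ Pr[KWA fails] + Pr[E's word ends at ans s]`, and the second term is bounded by
WordHard applied to the stand-alone word finder `z ↦ (sample A's coins r; E ⟨z, r⟩)`.  Provable now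
modulo PPT-closure plumbing (composition / coin-sampling facts of `RandAlg.IsPolyTime`). -/
def ClauseCOfKnowledge : Prop :=
  ∀ (M : WalkModel) (gen ans : List Bool → List Bool),
    Coherent M gen ans → KnowledgeOfWalk M gen → WordHard M gen ans → ClauseC gen ans

/-! ## §3 The transferred crux C⁺ and the checked glue to the disprover's `CruxShape` -/

/-- The type of the missing definition `obfuscatedGluedTreesGen` (verbatim, Disproof.lean §0). -/
abbrev GenType : Type :=
  CircuitObfuscator → PuncturablePRFScheme → (List Bool → List Bool) → ℕ →
    (List Bool → List Bool) × (List Bool → List Bool)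

/-- The typed shape of the crux (verbatim, Disproof.lean §0). -/
def CruxShape (obfGen : GenType) : Prop :=
  ∀ ε : ℝ, 0 < ε → ε < 1 → ∀ O : CircuitObfuscator, IsSubexpIO ε ppolyCircuits O →
    ∀ P : PuncturablePRFScheme,
      IsTDSecurePuncturablePRF P (fun κ => (2 : ℝ) ^ ((κ : ℝ) ^ ε))
        (fun κ => (2 : ℝ) ^ (-((κ : ℝ) ^ ε))) →
      ∀ f : List Bool → List Bool, IsOneWay f → Function.Injective f →
        ∀ c : ℕ, 1 < (c : ℝ) * ε → ClauseC (obfGen O P f c).1 (obfGen O P f c).2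

/-- **C⁺ (the transfer).**  Under the crux's own hypotheses, the generator satisfies KWA
(classical extractability of walks) AND WordHard (white-box path-finding hardness).  Stronger than
the crux (`cruxShape_of_cruxPlus`); the two conjuncts separate the classical-only content (KWA, no
hardness) from the hardness content (WordHard, no classical/quantum separation). -/
def CruxPlus (obfGen : GenType) (M : WalkModel) : Prop :=
  ∀ ε : ℝ, 0 < ε → ε < 1 → ∀ O : CircuitObfuscator, IsSubexpIO ε ppolyCircuits O →
    ∀ P : PuncturablePRFScheme,
      IsTDSecurePuncturablePRF P (fun κ => (2 : ℝ) ^ ((κ : ℝ) ^ ε))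
        (fun κ => (2 : ℝ) ^ (-((κ : ℝ) ^ ε))) →
      ∀ f : List Bool → List Bool, IsOneWay f → Function.Injective f →
        ∀ c : ℕ, 1 < (c : ℝ) * ε →
          KnowledgeOfWalk M (obfGen O P f c).1 ∧ WordHard M (obfGen O P f c).1 (obfGen O P f c).2

/-- **Checked glue**: the first lemma turns C⁺ into the disprover's typed crux shape, for any
walk model coherent with the generator. -/
theorem cruxShape_of_cruxPlus (h : ClauseCOfKnowledge) (obfGen : GenType) (M : WalkModel)
    (hcoh : ∀ O P f c, Coherent M (obfGen O P f c).1 (obfGen O P f c).2)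
    (hplus : CruxPlus obfGen M) : CruxShape obfGen := by
  intro ε hε hε1 O hO P hP f hf hinj c hc
  obtain ⟨hK, hW⟩ := hplus ε hε hε1 O hO P hP f hf hinj c hc
  exact h M _ _ (hcoh O P f c) hK hW

/-! ## §4 Black-box calibration: classical algorithms are rooted (CCDFGS Game 1 → Game 2) -/

namespace BlackBox

open GluedTrees

variable {n : ℕ}

/-- The vertices whose names have been REVEALED by the queries `qs` (answered by the oracle of the
outcome `ω`): the ENTRANCE and every neighbour of every validly named queried vertex. -/
def revealed (ω : Outcome n) (qs : List (List Bool)) : Set (Vertex n) :=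
  {entrance n} ∪ {w | ∃ q ∈ qs, ∃ v, List.ofFn (ω.2.1 v) = q ∧ (graph n ω.1).Adj v w}

/-- The run of the transcript algorithm `M` (input/advice `x`, `t` rounds) on outcome `ω` is
UNROOTED: some query names a vertex that the earlier queries had not revealed (a valid name
produced "without a walk"). -/
def Unrooted {β : Type} (M : OracleAlg β) (x : List Bool) (t : ℕ) (ω : Outcome n) : Prop :=
  ∃ i : ℕ, ∃ v : Vertex n,
    (M.queries (strOracle ω.1 ω.2.1) t x)[i]? = some (List.ofFn (ω.2.1 v)) ∧
      v ∉ revealed ω ((M.queries (strOracle ω.1 ω.2.1) t x).take i)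

open Classical in
/-- The fraction of outcomes (uniform graph, uniform naming) on which the run is unrooted. -/
noncomputable def unrootedProb (n : ℕ) {β : Type} (M : OracleAlg β) (x : List Bool) (t : ℕ) : ℝ :=
  ((Finset.univ.filter (Unrooted (n := n) M x t)).card : ℝ) / Fintype.card (Outcome n)

/-- **Classical rootedness in the black-box model** (CCDFGS 2003 §4, the step Game 1 → Game 2:
"unguessable names").  Conditioned on any history, the names of unrevealed vertices are uniform
among the strings not yet revealed or refuted, so each query names an unrevealed vertex with
probability `≤ 2^{n+2}/(2^{2n} − 4t − 1)`; union over `t` queries.  This is the ideal-model truth of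
KWA for classical machines (extract the walk from the transcript); its quantum analogue fails for
the walk of Theorem 3 unless quantum path finding is easy. -/
def ClassicalRootedness : Prop :=
  ∀ (n : ℕ) {β : Type} (M : OracleAlg β) (x : List Bool) (t : ℕ),
    4 * t + 1 < 2 ^ (2 * n) →
      unrootedProb n M x t ≤ t * (2 : ℝ) ^ (n + 2) / ((2 : ℝ) ^ (2 * n) - (4 * t + 1))

end BlackBox

/-! ## §5 The line's standing bet, typed: white-box path finding is hard for QUANTUM machines too

If a uniform poly-time quantum family found ENTRANCE→EXIT words for the obfuscated glued trees, a
black-box proof of `WordHard` from post-quantum primitives would be impossible (the shadow again) and the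
split would degenerate to a summit-circular conditional.  The conjecture below is the white-box form of the
open problem of Childs et al. 2003 / Childs–Coudron–Gilani 2022 (hardness proved there for genuine ROOTED
quantum algorithms only); Li 2023 (arXiv:2307.12492) gives a quantum path-finder for a welded-tree VARIANT,
not for `G'_n`.  It is NOT used in the proof of (C); it is the consistency condition "quantum KWA fails". -/

/-- **QuantumWordHard** (conjecture; advantage-neutrality of `WordHard`).  No poly-time uniform oracle-free
Clifford+T family, run on `gen s`, outputs (an encoding, via `decode`, of) a walk-word from the ENTRANCE to
the answer, except with probability decaying superpolynomially on average over the seed. -/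
def QuantumWordHard (M : WalkModel) (gen ans : List Bool → List Bool) (decode : List Bool → List ℕ) : Prop :=
  ∀ F : QCircuitFamily cliffordT, F.IsOracleFree → F.IsUniform →
    SuperpolynomialDecay atTop (fun n : ℕ => (n : ℝ)) (fun n : ℕ =>
      uniformAvg n fun s => F.kernelProb 0 (gen s) {y | M.endpoint (gen s) (decode y) = some (ans s)})

end Summit.QuantumAdvantage.QuantumAdvantage.Theses.WhiteBoxWalk.CruxIdeas.KnowledgeOfWalk
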